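import Summits.BirchSwinnertonDyer.Rank1Residual.X11b.Three.GoodReductionSubgroupCuspH1
import Summits.BirchSwinnertonDyer.Rank1Residual.X11b.Three.MultiplicativeMinimalBaseChange
import Literature.NumberTheory.EllipticCurves.SingularCubicPointCountProofs
import HarnessLib

/-!
# X11b at `p = 3` (team N8/O2), JET3-KUMMER (α) at an ADDITIVE place: the cusp PRESENTATION over
# a perfect residue field, and (α) from Mathlib's `HasAdditiveReduction` class

HONEST FRAMING (cell `b2b-bsdres`, run/shared/lean/b2b/bsd-rank1-residual/, verbatim in every
file): the goal of the cell is to DELETE the COMBINATION-SHAPED residual classes of the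
Birch–Swinnerton-Dyer formula for ALL analytic-rank `≤ 1` elliptic curves over `ℚ` — "full BSD
formula for every rank `≤ 1` curve in class `C`" assembled STRICTLY from published theorems — so
that the rank-`≤ 1` remainder becomes exactly the CONSTRUCTION-SHAPED classes, which are TYPED
(missing-input `Prop`s), NOT attempted. This is not "finishing BSD". Team N8/O2 = `x11b3`, seat
`b2b-bsdres-x11b3-p4` (owner of record of the S15 interface, LEAD DEAL #7 R7-7), S15 (v) "(α) at
ADDITIVE places", part 14. THEOREMS ONLY: no definition, no named fact, no `sorry`; nothing is
booked; `JET@p|N` NOT discharged.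

## What

* §1 **`exists_eq_singularModel_cusp_of_perfectField`** — a Weierstrass cubic `V` over a PERFECT
  field `k` with `Δ = 0` and `c₄ = 0` IS a presented cusp over `k` itself:
  `V = singularModel x₀ y₀ α α` with `x₀, y₀, α ∈ k`. Over `k̄` this is Silverman *AEC* III.1.4(a)
  / III.2.5 (tree: `exists_singularPoint`, `exists_tangentSlopes`, `eq_singularModel`,
  `singularModel.c₄_eq : c₄ = (α₁ − α₂)⁴`); the singular point and the (double) tangent slope are
  unique, hence fixed by `Aut(k̄/k)` (`singularModel.apply_eq_of_map_eq`), hence rational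
  (`InfiniteGalois.mem_range_algebraMap_iff_fixed`; `k̄/k` is Galois for perfect `k`) — the
  pattern of the tree's `exists_singularPoint_of_perfectField`.
* §2 In p1's dictionary: `residue_Δ_eq_zero_and_residue_c₄_eq_zero_of_hasAdditiveReduction`
  (Mathlib's `HasAdditiveReduction R` read on the `R`-model `W₀`: `Δ̄ = 0`, `c̄₄ = 0`) and
  **`exists_map_residue_eq_singularModel_cusp_of_hasAdditiveReduction`** (`k` finite):
  `W₀ mod 𝔪 = singularModel x₀ y₀ α α` — the hypothesis `hW` of part 13's `h1red_of_cusp`.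
* §2b `valuation_baseChange_c₄_lt_one`, **`hasAdditiveReduction_baseChange_of_isMinimal`** —
  along `R₀ → R` local, additive reduction of `X ⊗ F` over `R₀` gives additive reduction of
  `X ⊗ L` over `R` GIVEN `[(X.baseChange L).IsMinimal R]` (the residual input R7′, isolated).
* §3 Part 13 with `hW` DISCHARGED: **`h1red_of_hasAdditiveReduction`**,
  **`hα_of_h1ker_of_hasAdditiveReduction`**, **`hα_of_hasAdditiveReduction_of_adicComplete`**
  (p1's (α) is a THEOREM at every ADDITIVE place of a complete unramified layer with finite
  residue field, given minimality of the model over the layer),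
  `exists_baseChange_eq_add_pow_smul_of_hasAdditiveReduction_of_adicComplete`.

RESIDUAL BINDERS at an additive place (S15-INTERFACE.md §4, additive column): `hR`,
`[IsAdicComplete 𝔪 R]`, `[Finite k]` + `hcard`, `φ`/`hφ`/`hn`/`hfrob`, uniformiser from `F`,
`[IsGalois F L]` (end form), `[(X.baseChange L).HasAdditiveReduction R]` — which CONTAINS the
minimality of the equation over the layer (at an additive place minimality of the `K_v`-minimal
model over the unramified `L_w` is Tate's algorithm under unramified base change: NOT discharged
here), `X ⊗ L` elliptic.

References (locators only; no new fact): [cite: SilvermanAEC2009, Prop. III.1.4(a) (PDF p. 51),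
Prop. III.2.5(b) (PDF p. 59), VII.2 Prop. 2.1 (PDF p. 167), VII.§5] [cite: MilneADT2006, Ch. I
Prop. 3.8] [cite: Jetchev2008, Prop. 4.1 (p. 819)].

## Design

No definitions; `noncomputable section`; `open scoped Classical`. Axioms: `propext`,
`Classical.choice`, `Quot.sound`.
-/

noncomputable section

open scoped Classical

namespace Summit.BirchSwinnertonDyer.Rank1Residual.X11b.Three.JetchevKummer

open WeierstrassCurve Literature.NumberTheory.EllipticCurves

universe u

/-! ### §1 A cuspidal Weierstrass cubic over a perfect field is a presented cusp -/

section Perfect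

variable {k : Type*} [Field k] [PerfectField k] (V : WeierstrassCurve k)

/-- **A cuspidal Weierstrass cubic over a perfect field is a presented cusp over that field**:
if `Δ = 0` and `c₄ = 0` then `V = singularModel x₀ y₀ α α` for some `x₀, y₀, α ∈ k` (the unique
singular point and its double tangent slope, rational by Galois descent from `k̄`).
Silverman, *AEC*, Prop. III.1.4(a) and Prop. III.2.5(b).
[cite: SilvermanAEC2009, Prop. III.1.4(a) and Prop. III.2.5 (PDF pp. 51, 59)] -/
theorem exists_eq_singularModel_cusp_of_perfectField (hΔ : V.Δ = 0) (hc₄ : V.c₄ = 0) :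
    ∃ x₀ y₀ α : k, V = singularModel x₀ y₀ α α := by
  set kb := AlgebraicClosure k
  haveI : IsGalois k kb := {}
  set Vb := V.map (algebraMap k kb) with hVb
  have hΔb : Vb.Δ = 0 := by rw [hVb, map_Δ, hΔ, map_zero]
  obtain ⟨x, y, hE, hX, hY⟩ := Vb.exists_singularPoint hΔb
  obtain ⟨α₁, α₂, hs, hp⟩ := Vb.exists_tangentSlopes x
  have hmodel := Vb.eq_singularModel hE hX hY hs hp
  -- a cusp: the two slopes coincide
  have hα : α₁ = α₂ := by
    have h4 : (α₁ - α₂) ^ 4 = 0 := by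
      rw [← singularModel.c₄_eq x y α₁ α₂, ← hmodel, hVb, map_c₄, hc₄, map_zero]
    exact sub_eq_zero.mp ((pow_eq_zero_iff (by norm_num)).mp h4)
  subst hα
  -- every `k`-automorphism fixes `x`, `y` and the slope
  have hfix : ∀ τ : kb ≃ₐ[k] kb, τ x = x ∧ τ y = y ∧ τ α₁ = α₁ := by
    intro τ
    have hmap : (singularModel x y α₁ α₁).map (τ : kb →+* kb) = singularModel x y α₁ α₁ := by
      rw [← hmodel, hVb, map_map]
      congr 1
      ext a
      simp
    obtain ⟨h1, h2, h3⟩ := singularModel.apply_eq_of_map_eq hmap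
    exact ⟨h1, h2, by rcases h3 with ⟨h, -⟩ | ⟨h, -⟩ <;> exact h⟩
  obtain ⟨x₀, hx₀⟩ := (InfiniteGalois.mem_range_algebraMap_iff_fixed x).mpr fun τ ↦ (hfix τ).1
  obtain ⟨y₀, hy₀⟩ := (InfiniteGalois.mem_range_algebraMap_iff_fixed y).mpr fun τ ↦ (hfix τ).2.1
  obtain ⟨α, hα⟩ := (InfiniteGalois.mem_range_algebraMap_iff_fixed α₁).mpr fun τ ↦ (hfix τ).2.2
  refine ⟨x₀, y₀, α, WeierstrassCurve.map_injective (algebraMap k kb).injective ?_⟩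
  change V.map (algebraMap k kb) = (singularModel x₀ y₀ α α).map (algebraMap k kb)
  rw [singularModel.map_eq, hx₀, hy₀, hα, ← hVb, hmodel]

end Perfect

/-! ### §2 In p1's dictionary: the cusp presentation from `HasAdditiveReduction` -/

section Dictionary

variable {F : Type u} [Field F] (X : WeierstrassCurve F) (L : Type u) [Field L] [Algebra F L]
  (R : Type*) [CommRing R] [IsDomain R] [IsDiscreteValuationRing R] [Algebra R L]
  [IsFractionRing R L] (W₀ : WeierstrassCurve R) (hX : X.baseChange L = W₀.baseChange L)

include hX in
/-- At an additive place the `R`-model reduces to a singular cubic with `c̄₄ = 0` (Mathlib's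
`HasAdditiveReduction`: `v(Δ) < 1`, `v(c₄) < 1`, read on `W₀ = integralModel`). [folklore] -/
theorem residue_Δ_eq_zero_and_residue_c₄_eq_zero_of_hasAdditiveReduction
    [h : (X.baseChange L).HasAdditiveReduction R] :
    IsLocalRing.residue R W₀.Δ = 0 ∧ IsLocalRing.residue R W₀.c₄ = 0 := by
  have hI : (X.baseChange L).integralModel R = W₀ := integralModel_eq_of_baseChange_eq X L R W₀ hX
  have hΔ := h.badReduction
  have hc := h.additiveReduction
  rw [← integralModel_Δ_eq R (X.baseChange L), hI,
    valuation_algebraMap_lt_one_iff_not_isUnit] at hΔ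
  rw [← integralModel_c₄_eq R (X.baseChange L), hI, valuation_algebraMap_lt_one_iff_not_isUnit]
    at hc
  exact ⟨(IsLocalRing.residue_eq_zero_iff _).mpr ((IsLocalRing.mem_maximalIdeal _).mpr hΔ),
    (IsLocalRing.residue_eq_zero_iff _).mpr ((IsLocalRing.mem_maximalIdeal _).mpr hc)⟩

include hX in
/-- **Cusp presentation from `HasAdditiveReduction`** (p1's dictionary, `k` perfect — e.g.
finite): if `X ⊗ L` has additive reduction over `R` then its `R`-model reduces to a cusp PRESENTED
OVER `k`: `W₀ mod 𝔪 = singularModel x₀ y₀ α α` — the hypothesis `hW` of `h1red_of_cusp` /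
`hα_of_h1ker_of_cusp`. Silverman, *AEC*, VII.§5, III.1.4(a).
[cite: SilvermanAEC2009, VII.§5 (PDF p. 174), Prop. III.1.4(a)] -/
theorem exists_map_residue_eq_singularModel_cusp_of_hasAdditiveReduction
    [PerfectField (IsLocalRing.ResidueField R)] [(X.baseChange L).HasAdditiveReduction R] :
    ∃ x₀ y₀ α : IsLocalRing.ResidueField R,
      W₀.map (IsLocalRing.residue R) = singularModel x₀ y₀ α α := by
  obtain ⟨hΔ, hc⟩ := residue_Δ_eq_zero_and_residue_c₄_eq_zero_of_hasAdditiveReduction X L R W₀ hX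
  exact exists_eq_singularModel_cusp_of_perfectField (W₀.map (IsLocalRing.residue R))
    (by rw [map_Δ, hΔ]) (by rw [map_c₄, hc])

end Dictionary

/-! ### §2b Additive reduction along `R₀ → R` local, GIVEN minimality over the layer -/

section BaseChange

variable {F : Type u} [Field F] (X : WeierstrassCurve F) (L : Type u) [Field L] [Algebra F L]
  (R₀ : Type*) [CommRing R₀] [IsDomain R₀] [IsDiscreteValuationRing R₀] [Algebra R₀ F]
  [IsFractionRing R₀ F]
  (R : Type*) [CommRing R] [IsDomain R] [IsDiscreteValuationRing R] [Algebra R L]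
  [IsFractionRing R L]
  [Algebra R₀ R] [Algebra R₀ L] [IsScalarTower R₀ R L] [IsScalarTower R₀ F L]

/-- **`v_L(c₄) > 0` from `v_F(c₄) > 0`**: the local homomorphism `R₀ → R` maps non-units to
non-units (twin of `valuation_baseChange_Δ_lt_one`). [folklore] -/
theorem valuation_baseChange_c₄_lt_one [IsLocalHom (algebraMap R₀ R)]
    [(X.baseChange F).IsIntegral R₀]
    (h : (IsDiscreteValuationRing.maximalIdeal R₀).valuation F (X.baseChange F).c₄ < 1) :
    (IsDiscreteValuationRing.maximalIdeal R).valuation L (X.baseChange L).c₄ < 1 := by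
  rw [baseChange_c₄_eq X L R₀ R, valuation_algebraMap_lt_one_iff_not_isUnit]
  rw [← integralModel_c₄_eq R₀ (X.baseChange F), valuation_algebraMap_lt_one_iff_not_isUnit] at h
  exact fun hu ↦ h ((isUnit_map_iff (algebraMap R₀ R) _).mp hu)

/-- **Additive reduction along `R₀ → R` local, given minimality over the layer.** If `X ⊗ F` has
additive reduction over `R₀` (Mathlib: `R₀`-minimal with `v(Δ) > 0`, `v(c₄) > 0`) and the SAME
equation `X ⊗ L` is `R`-minimal, then `X ⊗ L` has additive reduction over `R`. The minimality
hypothesis `[(X.baseChange L).IsMinimal R]` is exactly the residual input R7′ of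
`S15-INTERFACE.md` at an additive place (minimal equations stay minimal under UNRAMIFIED
extensions — Tate's algorithm, Silverman *AEC* VII.5.4 / *ATAEC* IV.9; NOT proved here; at a
multiplicative place it is p4's `isMinimal_baseChange_of_hasMultiplicativeReduction`).
[cite: SilvermanAEC2009, Prop. VII.5.4 (PDF p. 175), VII.1 Remark 1.1] -/
theorem hasAdditiveReduction_baseChange_of_isMinimal [IsLocalHom (algebraMap R₀ R)]
    [h : (X.baseChange F).HasAdditiveReduction R₀] [hmin : (X.baseChange L).IsMinimal R] :
    (X.baseChange L).HasAdditiveReduction R :=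
  { toIsMinimal := hmin
    badReduction := valuation_baseChange_Δ_lt_one X L R₀ R h.badReduction
    additiveReduction := valuation_baseChange_c₄_lt_one X L R₀ R h.additiveReduction }

end BaseChange

/-! ### §3 Part 13 with the presentation discharged -/

section Discharge

variable {F : Type u} [Field F] (X : WeierstrassCurve F) (L : Type u) [Field L] [Algebra F L]
  (R : Type*) [CommRing R] [IsDomain R] [IsDiscreteValuationRing R] [Algebra R L]
  [IsFractionRing R L] [(X.baseChange L).HasAdditiveReduction R]
  [Finite (IsLocalRing.ResidueField R)]
  (W₀ : WeierstrassCurve R) (hX : X.baseChange L = W₀.baseChange L)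

include hX in
/-- **The `Ẽ_ns` half of (α) at an ADDITIVE place** — part 13's `h1red_of_cusp` with `hW`
discharged from `[(X.baseChange L).HasAdditiveReduction R]` (§2); remaining binders `hR`,
`hcard`, `hfrob` by name. [cite: SilvermanAEC2009, VII.2 Prop. 2.1, Prop. III.2.5(b), VII.§5]
[cite: SerreLocalFields1979, X §1 (Hilbert 90)] -/
theorem h1red_of_hasAdditiveReduction [HenselianRing R (IsLocalRing.maximalIdeal R)]
    (hR : ∀ (τ : L ≃ₐ[F] L) (x : L), x ∈ Set.range (algebraMap R L) →
      τ x ∈ Set.range (algebraMap R L))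
    (φ : L ≃ₐ[F] L) {q n : ℕ} (hcard : Nat.card (IsLocalRing.ResidueField R) = q ^ n)
    (hfrob : ∀ a : R, ∃ a' : R, algebraMap R L a' = φ (algebraMap R L a) ∧
      IsLocalRing.residue R a' = IsLocalRing.residue R a ^ q) :
    ∀ m ∈ (X.baseChange L).goodReductionSubgroup R, ∑ j ∈ Finset.range n, (φ ^ j) • m = 0 →
      ∃ c ∈ (X.baseChange L).goodReductionSubgroup R, m - (φ • c - c) ∈
        {Q : (X.baseChange L).toAffine.Point | ∀ (x y : L)
          (h : (X.baseChange L).toAffine.Nonsingular x y), Q = .some x y h →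
            x ∉ Set.range (algebraMap R L)} := by
  haveI : PerfectField (IsLocalRing.ResidueField R) := PerfectField.ofFinite
  obtain ⟨_, _, _, hW⟩ :=
    exists_map_residue_eq_singularModel_cusp_of_hasAdditiveReduction X L R W₀ hX
  exact h1red_of_cusp X L R W₀ hX hR hW φ hcard hfrob

include hX in
/-- **(α) from the formal-group stub alone, at an ADDITIVE place** — part 13's
`hα_of_h1ker_of_cusp` with `hW` discharged; remaining binders `hR`, `hφ`, `hn`, `hcard`, `hfrob`
and the stub `h1ker` (discharged by `h1ker_of_adicComplete` when `R` is complete: next theorem).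
[cite: MilneADT2006, Ch. I Prop. 3.8] [cite: SilvermanAEC2009, VII.2 Prop. 2.1, Prop. III.2.5(b)] -/
theorem hα_of_h1ker_of_hasAdditiveReduction [HenselianRing R (IsLocalRing.maximalIdeal R)]
    (hR : ∀ (τ : L ≃ₐ[F] L) (x : L), x ∈ Set.range (algebraMap R L) →
      τ x ∈ Set.range (algebraMap R L))
    (φ : L ≃ₐ[F] L) (hφ : ∀ σ : L ≃ₐ[F] L, σ ∈ Subgroup.zpowers φ) {q n : ℕ} (hn : φ ^ n = 1)
    (hcard : Nat.card (IsLocalRing.ResidueField R) = q ^ n)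
    (hfrob : ∀ a : R, ∃ a' : R, algebraMap R L a' = φ (algebraMap R L a) ∧
      IsLocalRing.residue R a' = IsLocalRing.residue R a ^ q)
    (h1ker : ∀ m ∈ {Q : (X.baseChange L).toAffine.Point | ∀ (x y : L)
        (h : (X.baseChange L).toAffine.Nonsingular x y), Q = .some x y h →
          x ∉ Set.range (algebraMap R L)},
      ∑ j ∈ Finset.range n, (φ ^ j) • m = 0 →
        ∃ P ∈ {Q : (X.baseChange L).toAffine.Point | ∀ (x y : L)
          (h : (X.baseChange L).toAffine.Nonsingular x y), Q = .some x y h →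
            x ∉ Set.range (algebraMap R L)}, φ • P - P = m) :
    ∀ Q : (X.baseChange L).toAffine.Point,
      (∀ σ : L ≃ₐ[F] L, σ • Q - Q ∈ (X.baseChange L).goodReductionSubgroup R) →
        ∃ Q' : (X.baseChange L).toAffine.Point, (∀ σ : L ≃ₐ[F] L, σ • Q' = Q') ∧
          Q - Q' ∈ (X.baseChange L).goodReductionSubgroup R := by
  haveI : PerfectField (IsLocalRing.ResidueField R) := PerfectField.ofFinite
  obtain ⟨_, _, _, hW⟩ :=
    exists_map_residue_eq_singularModel_cusp_of_hasAdditiveReduction X L R W₀ hX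
  exact hα_of_h1ker_of_cusp X L R W₀ hX hR hW φ hφ hn hcard hfrob h1ker

include hX in
/-- **(α) at an ADDITIVE place over a complete unramified layer — p1's hypothesis `hα` of
`JetchevKummerAtP` is a THEOREM here (no stub, no presentation hypothesis).** Hypotheses: `R`
complete DVR of `L` with finite residue field `k`, `#k = qⁿ`, all of `Aut(L/F)` preserving `R`,
`Aut(L/F) = ⟨φ⟩` with `φⁿ = 1` and `φ ≡ (x ↦ x^q)` on `k`, a uniformiser of `R` from `F`,
`X ⊗ L` elliptic with ADDITIVE reduction over `R` (Mathlib's class, which includes minimality).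
Milne, *ADT* I Prop. 3.8 (`H¹(k, 𝒜°) = 0`, additive special fibre) at a finite unramified level.
[cite: MilneADT2006, Ch. I Prop. 3.8] [cite: SilvermanAEC2009, VII.2 Prop. 2.1, Prop. III.2.5(b)] -/
theorem hα_of_hasAdditiveReduction_of_adicComplete [IsAdicComplete (IsLocalRing.maximalIdeal R) R]
    [(X.baseChange L).IsElliptic]
    (hR : ∀ (τ : L ≃ₐ[F] L) (x : L), x ∈ Set.range (algebraMap R L) →
      τ x ∈ Set.range (algebraMap R L))
    (φ : L ≃ₐ[F] L) (hφ : ∀ σ : L ≃ₐ[F] L, σ ∈ Subgroup.zpowers φ)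
    {q n : ℕ} (hn : φ ^ n = 1) (hcard : Nat.card (IsLocalRing.ResidueField R) = q ^ n)
    (hfrob : ∀ a : R, ∃ a' : R, algebraMap R L a' = φ (algebraMap R L a) ∧
      IsLocalRing.residue R a' = IsLocalRing.residue R a ^ q)
    {ϖ : R} (hϖ : Irreducible ϖ) {π : F} (hπ : algebraMap F L π = algebraMap R L ϖ) :
    ∀ Q : (X.baseChange L).toAffine.Point,
      (∀ σ : L ≃ₐ[F] L, σ • Q - Q ∈ (X.baseChange L).goodReductionSubgroup R) →
        ∃ Q' : (X.baseChange L).toAffine.Point, (∀ σ : L ≃ₐ[F] L, σ • Q' = Q') ∧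
          Q - Q' ∈ (X.baseChange L).goodReductionSubgroup R :=
  hα_of_h1ker_of_hasAdditiveReduction X L R W₀ hX hR φ hφ hn hcard hfrob
    (h1ker_of_adicComplete X L R W₀ hX hR φ hn hcard hfrob hϖ hπ)

include hX in
/-- **Jetchev's Prop. 4.1 at an ADDITIVE place, modulo p1's inputs (a), (b) and the cocycle
ONLY** (no stub, no presentation hypothesis): `T = ι(t₀ + p^m t₁)` with `t₀ ∈ E₀(K_v)`. The flag
`JET@p|N` is NOT discharged. [cite: Jetchev2008, Prop. 4.1 (p. 819)]
[cite: GrossLMS1991, Prop. 6.2 (1), pp. 244–245] [cite: MilneADT2006, Ch. I Prop. 3.8] -/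
theorem exists_baseChange_eq_add_pow_smul_of_hasAdditiveReduction_of_adicComplete [IsGalois F L]
    [IsAdicComplete (IsLocalRing.maximalIdeal R) R] [(X.baseChange L).IsElliptic]
    (R₀ : Type*) [CommRing R₀] [IsDomain R₀] [IsDiscreteValuationRing R₀] [Algebra R₀ F]
    [IsFractionRing R₀ F] [Algebra R₀ R] [Algebra R₀ L] [IsScalarTower R₀ R L]
    [IsScalarTower R₀ F L] [IsLocalHom (algebraMap R₀ R)] [(X.baseChange F).IsMinimal R₀]
    (hR : ∀ (τ : L ≃ₐ[F] L) (x : L), x ∈ Set.range (algebraMap R L) →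
      τ x ∈ Set.range (algebraMap R L))
    (φ : L ≃ₐ[F] L) (hφ : ∀ σ : L ≃ₐ[F] L, σ ∈ Subgroup.zpowers φ)
    {q n : ℕ} (hn : φ ^ n = 1) (hcard : Nat.card (IsLocalRing.ResidueField R) = q ^ n)
    (hfrob : ∀ a : R, ∃ a' : R, algebraMap R L a' = φ (algebraMap R L a) ∧
      IsLocalRing.residue R a' = IsLocalRing.residue R a ^ q)
    {ϖ : R} (hϖ : Irreducible ϖ) {π : F} (hπ : algebraMap F L π = algebraMap R L ϖ)
    {p m n' : ℕ} (hcop : Nat.Coprime n' (p ^ m)) {U P T : (X.baseChange L).toAffine.Point}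
    {Rσ : (L ≃ₐ[F] L) → (X.baseChange L).toAffine.Point}
    (hT : ∀ σ : L ≃ₐ[F] L, σ • T = T)
    (hP : (n' : ℤ) • P ∈ (X.baseChange L).goodReductionSubgroup R)
    (hRσ : ∀ σ : L ≃ₐ[F] L, (n' : ℤ) • Rσ σ ∈ (X.baseChange L).goodReductionSubgroup R)
    (hU : ∀ σ : L ≃ₐ[F] L, σ • U - U = Rσ σ) (hpU : ((p ^ m : ℕ) : ℤ) • U = P - T) :
    ∃ t₀ t₁ : (X.baseChange F).toAffine.Point,
      t₀ ∈ (X.baseChange F).goodReductionSubgroup R₀ ∧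
      T = Affine.Point.baseChange (W' := X.toAffine) F L (t₀ + ((p ^ m : ℕ) : ℤ) • t₁) :=
  exists_baseChange_eq_add_pow_smul X L R₀ R
    (fun σ _ hQ ↦ smul_mem_goodReductionSubgroup X L R hR σ hQ)
    (hα_of_hasAdditiveReduction_of_adicComplete X L R W₀ hX hR φ hφ hn hcard hfrob hϖ hπ)
    hcop hT hP hRσ hU hpU

end Discharge

end Summit.BirchSwinnertonDyer.Rank1Residual.X11b.Three.JetchevKummer

end
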